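import Summits.ValiantsHypothesis.ValiantsHypothesis.Theorems.NewtonFramesTwoProductsFrameRungTwoCoverThree

/-!
# Crux `TwoProducts` (stmt-5906), line `FrameRungTwo`: the `k = 2` cross-cancelling count REDUCED to the shallow-neighbour lemma

`crossCancel_of_shallowNeighbour`: one product on each of two dissociated frames, ANY number `t` of letters per coordinate, NO
hypothesis on the frames (carries / parallelogram coincidences allowed).  IF every cross-cancelling configuration satisfies the
SHALLOW-NEIGHBOUR DICHOTOMY (IX) of CALIBRATION-FrameRungTwo-g3.md §3 — the vertex word demotes at most three letters of its
key-top tuple, OR the vertex is `Σ w − (T'_p − y)` for a word `w` of the OTHER frame demoting at most two letters and a letter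
`y` of that frame — THEN the cross-cancelling vertices number `≤ (m t + 2)^8` (three-gap covering family of
`…FrameRungTwoCoverThree.lean`).  (IX) holds with member depth ≤ 1 / the double-gap form on parallelogram-free frames
(`vertex_form_three`), and was verified numerically without exception on ≈2·10⁵ carry-frame configurations; it is OPEN in general
(content: member depth ≥ 4 ⇒ shallow non-member neighbour).  So this file turns g2's "k ≤ 2 except carry frames" into
"k ≤ 2 for all frames, modulo ONE per-vertex structural lemma", and fixes that lemma's exact kernel shape (`hIX`, `hIX'`).
Honest scope: a CONDITIONAL count for ONE stub of a rung strictly below the crux `TwoProducts`; nothing here bears on `VP ≠ VNP`.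
[ours; setting KPTT arXiv:1308.2286 §2, §5]
-/

set_option linter.dupNamespace false

namespace Summit.ValiantsHypothesis.ValiantsHypothesis.Theorems.NewtonFramesTwoProducts.FrameRungTwoTrinomial

open MvPolynomial
open scoped BigOperators Classical
open Summit.ValiantsHypothesis.Theorems.DissociatedFixedK (lexKey lexKey_injective lexTop lexTop_mem lexKey_le_lexTop)
open Summit.ValiantsHypothesis.ValiantsHypothesis.Theorems.DissociatedFixedK.Negative (emb emb_injective)
open Summit.ValiantsHypothesis.ValiantsHypothesis.Theorems.NewtonFramesTwoProducts.FrameRungTwoBinomial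
  (emb_add emb_sum apply_le_of_lexKey_le lexKey_lt_of_apply_lt coeff_word exists_word prod_coeff_ne_zero top_eq
   cross_empty_of_union_subset)

noncomputable section

section Reduction

variable {m : ℕ}

/-- Final arithmetic: `2 (4X²+7)(X+1)³ ≤ (X+2)^8`. -/
theorem count_arith_cover3 (X : ℕ) : 2 * ((4 * X ^ 2 + 7) * (X + 1) ^ 3) ≤ (X + 2) ^ 8 := by
  have h1 : 4 * X ^ 2 + 7 ≤ 4 * (X + 2) ^ 2 :=
    calc 4 * X ^ 2 + 7 ≤ 4 * X ^ 2 + (16 * X + 16) := Nat.add_le_add_left (by omega) _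
      _ = 4 * (X + 2) ^ 2 := by ring
  have h2 : (X + 1) ^ 3 ≤ (X + 2) ^ 3 := Nat.pow_le_pow_left (by omega) 3
  have h3 : 8 ≤ (X + 2) ^ 3 := by
    calc 8 = 2 ^ 3 := by norm_num
      _ ≤ (X + 2) ^ 3 := Nat.pow_le_pow_left (by omega) 3
  calc 2 * ((4 * X ^ 2 + 7) * (X + 1) ^ 3) ≤ 2 * ((4 * (X + 2) ^ 2) * (X + 2) ^ 3) := by gcongr
    _ = 8 * (X + 2) ^ 5 := by ring
    _ ≤ (X + 2) ^ 3 * (X + 2) ^ 5 := Nat.mul_le_mul_right _ h3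
    _ = (X + 2) ^ 8 := by ring

/-- **The `k = 2` cross-cancelling count from the shallow-neighbour dichotomy (IX)** (two dissociated frames, one product each,
any `t`, carries allowed).  `hIX` / `hIX'` are (IX) for vertices whose word lives in `f` / in `g`. [ours] -/
theorem crossCancel_of_shallowNeighbour (m t : ℕ) (A B : Fin m → Finset (Fin 2 →₀ ℕ))
    (f g : Fin m → MvPolynomial (Fin 2) ℂ)
    (hA : ∀ j, (A j).card ≤ t) (hB : ∀ j, (B j).card ≤ t)
    (hf : ∀ j, (f j).support ⊆ A j) (hg : ∀ j, (g j).support ⊆ B j)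
    (hinjA : ∀ a b : Fin m → (Fin 2 →₀ ℕ), (∀ j, a j ∈ A j) → (∀ j, b j ∈ A j) → ∑ j, a j = ∑ j, b j → a = b)
    (hinjB : ∀ a b : Fin m → (Fin 2 →₀ ℕ), (∀ j, a j ∈ B j) → (∀ j, b j ∈ B j) → ∑ j, a j = ∑ j, b j → a = b)
    (hIX : ∀ (lc : (Fin 2 → ℝ) →L[ℝ] ℝ) (e : Fin 2 →₀ ℕ) (T T' a : Fin m → (Fin 2 →₀ ℕ)),
      (∀ j, T j ∈ (f j).support) → (∀ j, ∀ x ∈ (f j).support, lexKey lc x ≤ lexKey lc (T j)) →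
      (∀ j, T' j ∈ (g j).support) → (∀ j, ∀ x ∈ (g j).support, lexKey lc x ≤ lexKey lc (T' j)) →
      (∀ j, a j ∈ (f j).support) → ∑ j, a j = e →
      (∀ x : Fin 2 →₀ ℕ, x ≠ e → lc (emb e) ≤ lc (emb x) → coeff x (∏ j, f j) + coeff x (∏ j, g j) = 0) →
      coeff e (∏ j, f j) + coeff e (∏ j, g j) ≠ 0 → ∑ j, T j = ∑ j, T' j → lexKey lc e < lexKey lc (∑ j, T j) →
      (Finset.univ.filter fun i => a i ≠ T i).card ≤ 3 ∨
        ∃ (w : Fin m → (Fin 2 →₀ ℕ)) (p : Fin m) (y : Fin 2 →₀ ℕ), (∀ i, w i ∈ (g i).support) ∧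
          (Finset.univ.filter fun i => w i ≠ T' i).card ≤ 2 ∧ y ∈ (g p).support ∧
          emb e = emb (∑ i, w i) - (emb (T' p) - emb y))
    (hIX' : ∀ (lc : (Fin 2 → ℝ) →L[ℝ] ℝ) (e : Fin 2 →₀ ℕ) (T' T a : Fin m → (Fin 2 →₀ ℕ)),
      (∀ j, T' j ∈ (g j).support) → (∀ j, ∀ x ∈ (g j).support, lexKey lc x ≤ lexKey lc (T' j)) →
      (∀ j, T j ∈ (f j).support) → (∀ j, ∀ x ∈ (f j).support, lexKey lc x ≤ lexKey lc (T j)) →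
      (∀ j, a j ∈ (g j).support) → ∑ j, a j = e →
      (∀ x : Fin 2 →₀ ℕ, x ≠ e → lc (emb e) ≤ lc (emb x) → coeff x (∏ j, g j) + coeff x (∏ j, f j) = 0) →
      coeff e (∏ j, g j) + coeff e (∏ j, f j) ≠ 0 → ∑ j, T' j = ∑ j, T j → lexKey lc e < lexKey lc (∑ j, T' j) →
      (Finset.univ.filter fun i => a i ≠ T' i).card ≤ 3 ∨
        ∃ (w : Fin m → (Fin 2 →₀ ℕ)) (p : Fin m) (y : Fin 2 →₀ ℕ), (∀ i, w i ∈ (f i).support) ∧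
          (Finset.univ.filter fun i => w i ≠ T i).card ≤ 2 ∧ y ∈ (f p).support ∧
          emb e = emb (∑ i, w i) - (emb (T p) - emb y)) :
    {p : Fin 2 → ℝ | p ∈ Set.extremePoints ℝ (convexHull ℝ
          (emb '' ((∏ j, f j + ∏ j, g j).support : Set (Fin 2 →₀ ℕ)))) ∧
        ∃ l : (Fin 2 → ℝ) →ₗ[ℝ] ℝ,
          (∀ q ∈ emb '' ((∏ j, f j + ∏ j, g j).support : Set (Fin 2 →₀ ℕ)), q ≠ p → l q < l p) ∧
          ∃ q ∈ emb '' ((∏ j, f j).support : Set (Fin 2 →₀ ℕ)) ∪ emb '' ((∏ j, g j).support : Set (Fin 2 →₀ ℕ)),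
            l p < l q}.ncard ≤ (m * t + 2) ^ 8 := by
  by_cases h0 : (∀ j, f j ≠ 0) ∧ (∀ j, g j ≠ 0)
  swap
  · have hsub : (∏ j, f j).support ∪ (∏ j, g j).support ⊆ (∏ j, f j + ∏ j, g j).support := by
      rw [not_and_or] at h0
      rcases h0 with h | h
      · push Not at h
        obtain ⟨j, hj⟩ := h
        rw [Finset.prod_eq_zero (Finset.mem_univ j) hj, support_zero, Finset.empty_union, zero_add]
      · push Not at h
        obtain ⟨j, hj⟩ := h
        rw [Finset.prod_eq_zero (Finset.mem_univ j) hj, support_zero, Finset.union_empty, add_zero]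
    rw [cross_empty_of_union_subset _ _ _ hsub, Set.ncard_empty]
    exact Nat.zero_le _
  obtain ⟨hf0, hg0⟩ := h0
  have hnef : ∀ j, ((f j).support).Nonempty := fun j => by
    rw [Finset.nonempty_iff_ne_empty, Ne, MvPolynomial.support_eq_empty]; exact hf0 j
  have hneg : ∀ j, ((g j).support).Nonempty := fun j => by
    rw [Finset.nonempty_iff_ne_empty, Ne, MvPolynomial.support_eq_empty]; exact hg0 j
  have hSf : ∀ j, ((f j).support).card ≤ t := fun j => (Finset.card_le_card (hf j)).trans (hA j)
  have hSg : ∀ j, ((g j).support).card ≤ t := fun j => (Finset.card_le_card (hg j)).trans (hB j)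
  have hinjf : ∀ a b : Fin m → (Fin 2 →₀ ℕ), (∀ j, a j ∈ (f j).support) → (∀ j, b j ∈ (f j).support) →
      ∑ j, a j = ∑ j, b j → a = b := fun a b ha hb => hinjA a b (fun j => hf j (ha j)) (fun j => hf j (hb j))
  have hinjg : ∀ a b : Fin m → (Fin 2 →₀ ℕ), (∀ j, a j ∈ (g j).support) → (∀ j, b j ∈ (g j).support) →
      ∑ j, a j = ∑ j, b j → a = b := fun a b ha hb => hinjB a b (fun j => hg j (ha j)) (fun j => hg j (hb j))
  -- the two three-gap covering families
  set Uf : Finset (Fin 2 → ℝ) := ((Fintype.piFinset fun j => (f j).support).filter fun b =>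
        ∃ l : (Fin 2 → ℝ) →L[ℝ] ℝ, ∀ j, ∀ x ∈ (f j).support, lexKey l x ≤ lexKey l (b j)).biUnion fun b =>
      (((Finset.insertNone (Finset.univ.biUnion fun j => ((f j).support).image (Prod.mk j))) ×ˢ
         (Finset.insertNone (Finset.univ.biUnion fun j => ((f j).support).image (Prod.mk j)))) ×ˢ
         (Finset.insertNone (Finset.univ.biUnion fun j => ((f j).support).image (Prod.mk j)))).image fun q =>
        emb (∑ j, b j) - Option.elim q.1.1 (0 : Fin 2 → ℝ) (fun p => emb (b p.1) - emb p.2)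
          - Option.elim q.1.2 (0 : Fin 2 → ℝ) (fun p => emb (b p.1) - emb p.2)
          - Option.elim q.2 (0 : Fin 2 → ℝ) (fun p => emb (b p.1) - emb p.2) with hUf
  set Ug : Finset (Fin 2 → ℝ) := ((Fintype.piFinset fun j => (g j).support).filter fun b =>
        ∃ l : (Fin 2 → ℝ) →L[ℝ] ℝ, ∀ j, ∀ x ∈ (g j).support, lexKey l x ≤ lexKey l (b j)).biUnion fun b =>
      (((Finset.insertNone (Finset.univ.biUnion fun j => ((g j).support).image (Prod.mk j))) ×ˢ
         (Finset.insertNone (Finset.univ.biUnion fun j => ((g j).support).image (Prod.mk j)))) ×ˢ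
         (Finset.insertNone (Finset.univ.biUnion fun j => ((g j).support).image (Prod.mk j)))).image fun q =>
        emb (∑ j, b j) - Option.elim q.1.1 (0 : Fin 2 → ℝ) (fun p => emb (b p.1) - emb p.2)
          - Option.elim q.1.2 (0 : Fin 2 → ℝ) (fun p => emb (b p.1) - emb p.2)
          - Option.elim q.2 (0 : Fin 2 → ℝ) (fun p => emb (b p.1) - emb p.2) with hUg
  have hcover : {p : Fin 2 → ℝ | p ∈ Set.extremePoints ℝ (convexHull ℝ
          (emb '' ((∏ j, f j + ∏ j, g j).support : Set (Fin 2 →₀ ℕ)))) ∧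
        ∃ l : (Fin 2 → ℝ) →ₗ[ℝ] ℝ,
          (∀ q ∈ emb '' ((∏ j, f j + ∏ j, g j).support : Set (Fin 2 →₀ ℕ)), q ≠ p → l q < l p) ∧
          ∃ q ∈ emb '' ((∏ j, f j).support : Set (Fin 2 →₀ ℕ)) ∪ emb '' ((∏ j, g j).support : Set (Fin 2 →₀ ℕ)),
            l p < l q} ⊆ ↑(Uf ∪ Ug) := by
    rintro p ⟨hp, l, hl, q, hq, hlt⟩
    obtain ⟨e, he, rfl⟩ := extremePoints_convexHull_subset hp
    have he' : e ∈ (∏ j, f j + ∏ j, g j).support := he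
    set lc : (Fin 2 → ℝ) →L[ℝ] ℝ := LinearMap.toContinuousLinearMap l with hlc
    have hlcl : ∀ v, lc v = l v := fun v => rfl
    set T : Fin m → (Fin 2 →₀ ℕ) := fun j => lexTop lc ((f j).support) (hnef j) with hTdef
    set T' : Fin m → (Fin 2 →₀ ℕ) := fun j => lexTop lc ((g j).support) (hneg j) with hT'def
    have hT : ∀ j, T j ∈ (f j).support := fun j => lexTop_mem _ _ _
    have hT' : ∀ j, T' j ∈ (g j).support := fun j => lexTop_mem _ _ _
    have hTmax : ∀ j, ∀ x ∈ (f j).support, lexKey lc x ≤ lexKey lc (T j) := fun j x hx => lexKey_le_lexTop _ _ _ hx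
    have hTmax' : ∀ j, ∀ x ∈ (g j).support, lexKey lc x ≤ lexKey lc (T' j) := fun j x hx => lexKey_le_lexTop _ _ _ hx
    have hzero : ∀ x : Fin 2 →₀ ℕ, x ≠ e → lc (emb e) ≤ lc (emb x) →
        coeff x (∏ j, f j) + coeff x (∏ j, g j) = 0 := by
      intro x hxe hle
      by_contra hne
      have hx : x ∈ (∏ j, f j + ∏ j, g j).support := by rw [mem_support_iff, coeff_add]; exact hne
      have h := hl (emb x) ⟨x, hx, rfl⟩ (fun h => hxe (emb_injective h))
      rw [hlcl, hlcl] at hle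
      exact absurd h (not_lt.2 hle)
    have hzero' : ∀ x : Fin 2 →₀ ℕ, x ≠ e → lc (emb e) ≤ lc (emb x) →
        coeff x (∏ j, g j) + coeff x (∏ j, f j) = 0 := fun x hx hle => by rw [add_comm]; exact hzero x hx hle
    have heF : coeff e (∏ j, f j) + coeff e (∏ j, g j) ≠ 0 := by
      rw [← coeff_add]; exact mem_support_iff.1 he'
    have heF' : coeff e (∏ j, g j) + coeff e (∏ j, f j) ≠ 0 := by rwa [add_comm]
    have htops : ∑ j, T j = ∑ j, T' j ∧ lexKey lc e < lexKey lc (∑ j, T j) := by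
      rcases hq with ⟨x, hx, rfl⟩ | ⟨x, hx, rfl⟩
      · exact top_eq lc f g T T' hT hTmax hT' hTmax' hinjf hinjg e hzero ⟨x, hx, by rwa [hlcl, hlcl]⟩
      · have h := top_eq lc g f T' T hT' hTmax' hT hTmax hinjg hinjf e hzero' ⟨x, hx, by rwa [hlcl, hlcl]⟩
        refine ⟨h.1.symm, ?_⟩
        rw [← h.1]; exact h.2
    obtain ⟨htop, hTe⟩ := htops
    have hTe' : lexKey lc e < lexKey lc (∑ j, T' j) := htop ▸ hTe
    rw [Finset.coe_union]
    rcases Finset.mem_union.1 (support_add he') with hef | heg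
    · obtain ⟨a, ha, hae⟩ := exists_word f hinjf hef
      rcases hIX lc e T T' a hT hTmax hT' hTmax' ha hae hzero heF htop hTe with hc | ⟨w, p', y, hw, hwc, hy, hE⟩
      · rw [← hae]
        exact Or.inl (mem_cover3_of_card_le_three lc f T hT hTmax a ha hc)
      · rw [hE]
        exact Or.inr (mem_cover3_of_neighbour lc g T' hT' hTmax' w hw hwc p' y hy)
    · obtain ⟨a, ha, hae⟩ := exists_word g hinjg heg
      rcases hIX' lc e T' T a hT' hTmax' hT hTmax ha hae hzero' heF' htop.symm hTe' with hc | ⟨w, p', y, hw, hwc, hy, hE⟩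
      · rw [← hae]
        exact Or.inr (mem_cover3_of_card_le_three lc g T' hT' hTmax' a ha hc)
      · rw [hE]
        exact Or.inl (mem_cover3_of_neighbour lc f T hT hTmax w hw hwc p' y hy)
  calc _ ≤ (↑(Uf ∪ Ug) : Set (Fin 2 → ℝ)).ncard := Set.ncard_le_ncard hcover (Finset.finite_toSet _)
    _ = (Uf ∪ Ug).card := Set.ncard_coe_finset _
    _ ≤ Uf.card + Ug.card := Finset.card_union_le _ _
    _ ≤ (4 * (m * t) ^ 2 + 7) * (m * t + 1) ^ 3 + (4 * (m * t) ^ 2 + 7) * (m * t + 1) ^ 3 :=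
        Nat.add_le_add (card_cover3_le t f hSf) (card_cover3_le t g hSg)
    _ = 2 * ((4 * (m * t) ^ 2 + 7) * (m * t + 1) ^ 3) := by ring
    _ ≤ (m * t + 2) ^ 8 := count_arith_cover3 (m * t)

end Reduction

end

end Summit.ValiantsHypothesis.ValiantsHypothesis.Theorems.NewtonFramesTwoProducts.FrameRungTwoTrinomial
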